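import Mathlib
import HarnessLib

/-!
# Stub `stub_normalEqSolvable` of line `Sketch` (idea `nash-doubling-debris`), crux
`HoelderEscapeProfile.LocalEnergyHalfHoelder` (stmt-AtomisticToContinuum-16008):
a coercive form on the window `[-L, L]` has solvable normal equations

Pure finite-dimensional linear algebra.  On the window `W := Finset.Icc (-L) L ⊂ ℤ` consider the
linear endomorphism of the (finite-dimensional) space of functions `↥W → ℝ`,
`(T b) y := Σ_{x ∈ W} b x * G (x - y)`, realised as `Matrix.mulVecLin` of the matrix
`(y, x) ↦ G (x - y)`.  If the quadratic form `a ↦ Σ_x Σ_y a_x a_y G (y - x)` is coercive on `W` with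
a constant `χm > 0`, then `T b = 0` forces `χm Σ b² ≤ Σ_x b_x (T b)_x = 0` (coercivity tested on the
extension by zero of `b`), so `b = 0`: `T` is injective, hence (`LinearMap.surjective_of_injective`)
surjective, and every right-hand side `v` is of the form `v y = Σ_{x ∈ W} ap x * G (x - y)`
(`|y| ≤ L`) with `ap` the extension by zero of a preimage.

No named fact is used; everything is Mathlib.

## Contents
* `sum_window_eq_sum_coe_of_eq` — a window sum against a function agreeing with `b` on the window is
  the corresponding sum over the subtype `↥W`;
* `normalEqMap_apply` — unfolding the matrix action `(T b) y = Σ_{x : ↥W} b x * G (x - y)`;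
* `normalEqMap_injective` — coercivity ⇒ injectivity;
* `normalEqSolvable` — the solvability statement with its signature spelled out;
* `Stmt.stub_normalEqSolvable`, `stub_normalEqSolvable` — the registered stub, verbatim
  (`theorem stub_normalEqSolvable : Stmt.stub_normalEqSolvable`).
-/

noncomputable section

namespace Summit.AtomisticToContinuum.FouriersLaw.Theorems.LocalEnergyHalfHoelder.NashDoubling

/-- A window sum against a function `a` that agrees with `b` on the window `W` is the
corresponding sum over the subtype `↥W`. -/
theorem sum_window_eq_sum_coe_of_eq (W : Finset ℤ) (b : ↥W → ℝ) (a g : ℤ → ℝ)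
    (ha : ∀ x : ↥W, a x = b x) :
    ∑ x ∈ W, a x * g x = ∑ x : ↥W, b x * g x := by
  rw [← Finset.sum_coe_sort]
  exact Finset.sum_congr rfl fun x _ => by rw [ha]

/-- Unfolding the normal-equation map: for the matrix `(y, x) ↦ G (x - y)` on the window,
`(T b) y = Σ_{x : ↥W} b x * G (x - y)`. -/
theorem normalEqMap_apply (W : Finset ℤ) (G : ℤ → ℝ) (b : ↥W → ℝ) (y : ↥W) :
    (Matrix.of fun y x : ↥W => G (x - y)).mulVecLin b y = ∑ x : ↥W, b x * G (x - y) := by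
  simp only [Matrix.mulVecLin_apply, Matrix.mulVec, dotProduct, Matrix.of_apply]
  exact Finset.sum_congr rfl fun x _ => mul_comm _ _

/-- **Coercivity ⇒ injectivity.** If `χm Σ_{x∈W} a_x² ≤ Σ_x Σ_y a_x a_y G (y - x)` for all `a`, with
`χm > 0`, then the normal-equation map `T` on `W` is injective: for `b` in the kernel, testing the
coercivity on the extension by zero of `b` gives `χm Σ b² ≤ Σ_x b_x (T b)_x = 0`. -/
theorem normalEqMap_injective (W : Finset ℤ) (G : ℤ → ℝ) (χm : ℝ) (hχ : 0 < χm)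
    (hcoer : ∀ a : ℤ → ℝ, χm * ∑ x ∈ W, a x ^ 2 ≤ ∑ x ∈ W, ∑ y ∈ W, a x * a y * G (y - x)) :
    Function.Injective (Matrix.of fun y x : ↥W => G (x - y)).mulVecLin := by
  rw [← LinearMap.ker_eq_bot, LinearMap.ker_eq_bot']
  intro b hb
  -- the extension by zero of `b`
  obtain ⟨a, ha⟩ : ∃ a : ℤ → ℝ, ∀ x : ↥W, a x = b x :=
    ⟨fun z => if h : z ∈ W then b ⟨z, h⟩ else 0, fun x => by simp [x.2]⟩
  have h1 := hcoer a
  have h2 : ∑ x ∈ W, ∑ y ∈ W, a x * a y * G (y - x) = 0 := by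
    calc ∑ x ∈ W, ∑ y ∈ W, a x * a y * G (y - x)
        = ∑ x ∈ W, a x * ∑ y ∈ W, a y * G (y - x) := by
          refine Finset.sum_congr rfl fun x _ => ?_
          rw [Finset.mul_sum]
          exact Finset.sum_congr rfl fun y _ => by ring
      _ = ∑ x : ↥W, b x * (Matrix.of fun y x : ↥W => G (x - y)).mulVecLin b x := by
          rw [← Finset.sum_coe_sort]
          refine Finset.sum_congr rfl fun x _ => ?_
          rw [ha, sum_window_eq_sum_coe_of_eq W b a _ ha, normalEqMap_apply]
      _ = 0 := by simp [hb]
  rw [h2] at h1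
  have h3 : ∑ x ∈ W, a x ^ 2 ≤ 0 := not_lt.1 fun h => absurd h1 (not_le.2 (mul_pos hχ h))
  have h4 : ∀ x ∈ W, a x ^ 2 = 0 :=
    (Finset.sum_eq_zero_iff_of_nonneg fun x _ => sq_nonneg (a x)).1
      (le_antisymm h3 (Finset.sum_nonneg fun x _ => sq_nonneg _))
  funext x
  have h5 := h4 x x.2
  rw [ha] at h5
  simpa using h5

/-- **Solvability of coercive normal equations on a window (explicit form).** A coercive form on
the window `[-L,L]` has solvable normal equations: for every right-hand side `v` there is `ap` with
`v_y = Σₓ apₓ G(x−y)` for `|y| ≤ L` (the linear map is injective by coercivity, hence surjective on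
the finite-dimensional space of functions on the window). -/
theorem normalEqSolvable : ∀ (L : ℕ) (G v : ℤ → ℝ) (χm : ℝ), 0 < χm → (∀ a : ℤ → ℝ, χm * ∑ x ∈ Finset.Icc (-(L:ℤ)) (L:ℤ), a x ^ 2 ≤ ∑ x ∈ Finset.Icc (-(L:ℤ)) (L:ℤ), ∑ y ∈ Finset.Icc (-(L:ℤ)) (L:ℤ), a x * a y * G (y - x)) → ∃ ap : ℤ → ℝ, ∀ y ∈ Finset.Icc (-(L:ℤ)) (L:ℤ), v y = ∑ x ∈ Finset.Icc (-(L:ℤ)) (L:ℤ), ap x * G (x - y) := by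
  intro L G v χm hχ hcoer
  have hsurj : Function.Surjective
      (Matrix.of fun y x : ↥(Finset.Icc (-(L:ℤ)) (L:ℤ)) => G (x - y)).mulVecLin :=
    LinearMap.surjective_of_injective (normalEqMap_injective _ G χm hχ hcoer)
  obtain ⟨b, hb⟩ := hsurj fun y => v y
  -- the extension by zero of the preimage `b`
  obtain ⟨ap, hap⟩ : ∃ ap : ℤ → ℝ, ∀ x : ↥(Finset.Icc (-(L:ℤ)) (L:ℤ)), ap x = b x :=
    ⟨fun z => if h : z ∈ Finset.Icc (-(L:ℤ)) (L:ℤ) then b ⟨z, h⟩ else 0, fun x => by simp [x.2]⟩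
  refine ⟨ap, fun y hy => ?_⟩
  have h := congrFun hb ⟨y, hy⟩
  rw [normalEqMap_apply] at h
  rw [sum_window_eq_sum_coe_of_eq _ b ap _ hap]
  exact h.symm

/-- **Statement of the registered stub `stub_normalEqSolvable`** (verbatim copy of
`Stmt.stub_normalEqSolvable` of the skeleton `Cruxes/LocalEnergyHalfHoelder/Lines/Sketch.lean`, in
this file's namespace so the skeleton can import it without a clash). A coercive form on the window
`[-L,L]` has solvable normal equations: for every right-hand side `v` there is `ap` with
`v_y = Σₓ apₓ G(x−y)` for `|y| ≤ L`. -/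
abbrev Stmt.stub_normalEqSolvable : Prop :=
    ∀ (L : ℕ) (G v : ℤ → ℝ) (χm : ℝ), 0 < χm → (∀ a : ℤ → ℝ, χm * ∑ x ∈ Finset.Icc (-(L:ℤ)) (L:ℤ), a x ^ 2 ≤ ∑ x ∈ Finset.Icc (-(L:ℤ)) (L:ℤ), ∑ y ∈ Finset.Icc (-(L:ℤ)) (L:ℤ), a x * a y * G (y - x)) → ∃ ap : ℤ → ℝ, ∀ y ∈ Finset.Icc (-(L:ℤ)) (L:ℤ), v y = ∑ x ∈ Finset.Icc (-(L:ℤ)) (L:ℤ), ap x * G (x - y)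

/-- **Registered stub `stub_normalEqSolvable`** (type `Stmt.stub_normalEqSolvable`, verbatim the
skeleton's): a coercive form on the window `[-L,L]` has solvable normal equations (injective ⇒
surjective on the finite-dimensional space of functions on the window; `normalEqSolvable`). -/
theorem stub_normalEqSolvable : Stmt.stub_normalEqSolvable :=
  normalEqSolvable

end Summit.AtomisticToContinuum.FouriersLaw.Theorems.LocalEnergyHalfHoelder.NashDoubling

end
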